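import Summits.NavierStokesRegularity.NavierStokesRegularity.Theses.CoreLogGas
import Summits.NavierStokesRegularity.NavierStokesRegularity.Theorems.CoreLogGasBlowupIsLocallyDrivenFarFieldReduction
import Summits.NavierStokesRegularity.NavierStokesRegularity.Theorems.CoreLogGasBlowupIsLocallyDrivenCoresCollapse
import HarnessLib.Audit

/-!
# Skeleton (line `registered`, rev c1b) of the crux `CoreLogGas.BlowupIsLocallyDriven`

(crux item `stmt-NavierStokesRegularity-11291`, rank 4, route `route-NavierStokesRegularity-CoreLogGas`; tree path
`Cruxes/BlowupIsLocallyDriven/Lines/registered.lean`; birth skeleton by `planner-skel-stmt-NavierStokesRegularity-11291-0`,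
reshaped by the lead `prover-line-stmt-NavierStokesRegularity-11291-c1-0`, 2026-08-17.)

THE CRUX (B). Every maximal finite-energy classical solution from Clay data admits `M ≥ 1`, `t₀ < T` and an integrable `g`
such that at every DEEP near-maximum vorticity point `x` with canonical core radius `ρ`, the SYMMETRIC part of
`∇u(t,x) − ∇(BS[1_{B(x,Mρ)} ω(t)])(x)` is `≤ g(t)`.

WHAT HAS LANDED (all `--supports stmt-NavierStokesRegularity-11291`, namespace `…Theorems.BlowupIsLocallyDriven.Registered`):
* the FAR FIELD: `stub_farSupportGrad` (p149558), `stub_centreGrad` (p151767), `stub_curlIntegralBall` (p150254), the derived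
  unconditional far-field strain bound `farFieldStrain` and the reduction `blowupIsLocallyDriven_of_shellLocality`
  (B ⟸ shell locality; p152530, file `CoreLogGasBlowupIsLocallyDrivenFarFieldReduction.lean`);
* the ENSTROPHY control `stub_enstrophyControl` (p148607);
* the REGIME REDUCTION: `coresCollapse` (at blow-up the canonical quarter-max cores collapse: ∀ ρ₀ > 0 ∀ t₁ < T there is
  an admissible triple of radius < ρ₀ on [t₁,T); enstrophy lower bound + BKM) and `shellLocality_of_collapseCase`
  (shell locality ⟸ shell locality for solutions with collapsing cores) — file `CoreLogGasBlowupIsLocallyDrivenCoresCollapse.lean`.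

THE ONE OPEN STUB `stub_shellLocalityCollapse` [XL, OPEN — the structural content of the crux]: SHELL LOCALITY IN THE
COLLAPSING-CORE REGIME. For a maximal solution whose canonical cores collapse (the hypothesis is automatic by `coresCollapse`,
it is displayed only to name the regime), there are `M ≥ 1`, `t₀ < T`, `R > 0`, `g₁ ∈ L¹(t₀,T)` bounding at every admissible
`(t,x,ρ)` with `Mρ ≤ R` the symmetric gradient induced at `x` by the vorticity in the shell `B(x,R) ∖ B(x,Mρ)`. This is where
tube / tight binary / blob versus collapsing SHEET lives; the refuters' frozen-shape computations (sheet (2/π)Ω/M, off-axis tube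
≈ 0.4Ω/M⁴, pair 3Γd²/(16πM⁴ρ⁴), ring ∼ Ω/M²; `∫Ω = ∞` by BKM) say it FAILS at fixed `M` for every self-similar collapse, so a
proof must show that genuine blow-up de-concentrates — crux-sized.

Composition: `BlowupIsLocallyDriven_of : Theses.CoreLogGas.BlowupIsLocallyDriven :=
blowupIsLocallyDriven_of_shellLocality (shellLocality_of_collapseCase stub_shellLocalityCollapse)` (all glue landed).
-/

noncomputable section

open Set MeasureTheory Filter Topology Metric

namespace Summit.NavierStokesRegularity.NavierStokesRegularity.Cruxes.BlowupIsLocallyDriven.Birth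

set_option linter.unusedVariables false
set_option linter.dupNamespace false

/-- **stub — `stub_shellLocalityCollapse` (XL, OPEN; the structural content of the crux).** SHELL LOCALITY IN THE
COLLAPSING-CORE REGIME: for every maximal finite-energy classical solution from Clay data whose canonical quarter-max cores
collapse (∀ ρ₀ > 0, ∀ t₁ ∈ [0,T), ∃ t ∈ [t₁,T) with an admissible triple `(x, ρ)`, `ρ < ρ₀` — automatic by `coresCollapse`),
there are `M ≥ 1`, `t₀ < T`, `R > 0` and an integrable `g₁` on `[t₀,T)` such that at every deep near-maximum vorticity point
`x` with canonical core radius `ρ` and `Mρ ≤ R`, the symmetric part of the gradient induced at `x` by the vorticity in the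
shell `B(x,R) ∖ B(x,Mρ)` (difference of the two truncated Biot–Savart gradients, written out as in the crux) is `≤ g₁(t)`. -/
theorem stub_shellLocalityCollapse :
    ∀ (ν T : ℝ), 0 < ν → 0 < T →
    ∀ (u : ℝ → EuclideanSpace ℝ (Fin 3) → EuclideanSpace ℝ (Fin 3)) (p : ℝ → EuclideanSpace ℝ (Fin 3) → ℝ),
      Literature.Analysis.FluidPDE.IsMaximalSmoothSolution ν 0 u p T →
      Literature.Analysis.FluidPDE.IsLerayHopfOn T ν 0 (u 0) u →
      Literature.Analysis.FluidPDE.HasRapidSpatialDecay (u 0) →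
      (∀ (ρ₀ : ℝ), 0 < ρ₀ → ∀ t₁ ∈ Set.Ico 0 T, ∃ t ∈ Set.Ico t₁ T,
        ∃ (x : EuclideanSpace ℝ (Fin 3)) (ρ : ℝ), 0 < ρ ∧ ρ < ρ₀ ∧
          (⨆ z, ‖Literature.Analysis.FluidPDE.curl (u t) z‖) ≤ 2 * ‖Literature.Analysis.FluidPDE.curl (u t) x‖ ∧
          Metric.ball x ρ ⊆ {y | (⨆ z, ‖Literature.Analysis.FluidPDE.curl (u t) z‖) ≤ 4 * ‖Literature.Analysis.FluidPDE.curl (u t) y‖} ∧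
          (∀ (x' : EuclideanSpace ℝ (Fin 3)) (ρ' : ℝ),
            (⨆ z, ‖Literature.Analysis.FluidPDE.curl (u t) z‖) ≤ 2 * ‖Literature.Analysis.FluidPDE.curl (u t) x'‖ →
            Metric.ball x' ρ' ⊆ {y | (⨆ z, ‖Literature.Analysis.FluidPDE.curl (u t) z‖) ≤ 4 * ‖Literature.Analysis.FluidPDE.curl (u t) y‖} →
            ρ' ≤ 2 * ρ)) →
      ∃ (M t₀ R : ℝ) (g₁ : ℝ → ℝ), 1 ≤ M ∧ 0 ≤ t₀ ∧ t₀ < T ∧ 0 < R ∧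
        MeasureTheory.IntegrableOn g₁ (Set.Ico t₀ T) ∧
        ∀ t ∈ Set.Ico t₀ T, ∀ (x : EuclideanSpace ℝ (Fin 3)) (ρ : ℝ), 0 < ρ → M * ρ ≤ R →
          (⨆ z, ‖Literature.Analysis.FluidPDE.curl (u t) z‖) ≤ 2 * ‖Literature.Analysis.FluidPDE.curl (u t) x‖ →
          Metric.ball x ρ ⊆ {y | (⨆ z, ‖Literature.Analysis.FluidPDE.curl (u t) z‖) ≤ 4 * ‖Literature.Analysis.FluidPDE.curl (u t) y‖} →
          (∀ (x' : EuclideanSpace ℝ (Fin 3)) (ρ' : ℝ),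
            (⨆ z, ‖Literature.Analysis.FluidPDE.curl (u t) z‖) ≤ 2 * ‖Literature.Analysis.FluidPDE.curl (u t) x'‖ →
            Metric.ball x' ρ' ⊆ {y | (⨆ z, ‖Literature.Analysis.FluidPDE.curl (u t) z‖) ≤ 4 * ‖Literature.Analysis.FluidPDE.curl (u t) y‖} →
            ρ' ≤ 2 * ρ) →
          ∀ e : EuclideanSpace ℝ (Fin 3), ‖e‖ = 1 →
            |inner ℝ ((fderiv ℝ (fun z : EuclideanSpace ℝ (Fin 3) => ∫ y, (4 * Real.pi * ‖z - y‖ ^ 3)⁻¹ • Literature.Analysis.FluidPDE.cross ((Metric.ball x R).indicator (Literature.Analysis.FluidPDE.curl (u t)) y) (z - y)) x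
              - fderiv ℝ (fun z : EuclideanSpace ℝ (Fin 3) => ∫ y, (4 * Real.pi * ‖z - y‖ ^ 3)⁻¹ • Literature.Analysis.FluidPDE.cross ((Metric.ball x (M * ρ)).indicator (Literature.Analysis.FluidPDE.curl (u t)) y) (z - y)) x) e) e|
              ≤ g₁ t := by
  sorry

/-- **Composition (the skeleton theorem, A12 shape).** The crux BY NAME from the one open stub: shell locality in the
collapsing-core regime ⇒ shell locality (`shellLocality_of_collapseCase`, via `coresCollapse`) ⇒ B
(`blowupIsLocallyDriven_of_shellLocality`: far field `farFieldStrain` + energy + `stub_enstrophyControl`). -/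
theorem BlowupIsLocallyDriven_of : Theses.CoreLogGas.BlowupIsLocallyDriven :=
  Theorems.BlowupIsLocallyDriven.Registered.blowupIsLocallyDriven_of_shellLocality
    (Theorems.BlowupIsLocallyDriven.Registered.shellLocality_of_collapseCase stub_shellLocalityCollapse)

end Summit.NavierStokesRegularity.NavierStokesRegularity.Cruxes.BlowupIsLocallyDriven.Birth
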